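import Mathlib.Tactic.Linarith
import Summits.CriticalPhenomena.PercolationContinuityZ3.Theorems.PercNearOneGluingNoHeavyLowerTailSahiCTCCoLevelTwoSplit
import Summits.CriticalPhenomena.PercolationContinuityZ3.Theorems.PercNearOneGluingNoHeavyLowerTailSahiCTCLadderSingleEdge
import HarnessLib

/-!
# `NoHeavyLowerTail` (crux stmt-CriticalPhenomena-4575), P3 lane: the co-level-2 row `M₂ ∈ ℕ[s]` for EVERY pair of up-sets whose all-live parts
# share exactly one 2-set (loops and small members unrestricted)

Support file (seat `prim-l12-p3`, gen 24; `--supports stmt-CriticalPhenomena-4575`).  Memo `run/shared/lean/prim/prim-l12/FROM-prim-l12-p3-g24-VALUE-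
LEVEL-TH2K.md` §3c, §5.8.  Combines `…SahiCTCCoLevelTwoSplit.coeff_Mtwo_nonneg_of_ladder` (`M₂ = Π·T + e₂·R'`, `R' ≥ 0`) with the single-edge ladder theorem
`…SahiCTCLadderSingleEdge.coeff_ladder_two_singleEdge_nonneg` applied to the all-live parts `{S ∈ 𝒳 : #S ≥ 2}`, `{S ∈ 𝒵 : #S ≥ 2}`.
* **`coeff_Mtwo_nonneg_of_singleEdge`** : for up-sets `𝒳, 𝒵` with `{u,v} ∈ 𝒳 ∩ 𝒵` the only common 2-set, the open-language co-level-2 master polynomial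
  (the `t = 2` case of `…SahiCTCLevelDuality.Mop`, written out) has nonnegative coefficients — so, via the level duality, the (TC) row of the slot
  "at least two of k open" holds for these pairs (not restated here).  Nothing is asserted about the crux.
-/

namespace Summit.CriticalPhenomena.PercolationContinuityZ3.Theorems.SahiCTCForms

open Finset MvPolynomial SahiCTCGenFun

variable {α : Type*} [DecidableEq α] [Fintype α]

/-- **`M₂(𝒳,𝒵) ∈ ℕ[s]` whenever the all-live parts share exactly one 2-set `{u,v}`** (any up-sets `𝒳, 𝒵`; loops and small members allowed). [this work] -/
theorem coeff_Mtwo_nonneg_of_singleEdge {𝒳 𝒵 : Finset (Finset α)} (h𝒳 : IsUpperSet (𝒳 : Set (Finset α)))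
    (h𝒵 : IsUpperSet (𝒵 : Set (Finset α))) {u v : α} (huv : u ≠ v) (he𝒳 : {u, v} ∈ 𝒳) (he𝒵 : {u, v} ∈ 𝒵)
    (hW : ((𝒳 ∩ 𝒵).filter fun S => #S = 2) = {{u, v}}) (n : α →₀ ℕ) :
    0 ≤ ((gf (bySize (· = 2)) * gf univ.powerset) * (gf univ.powerset * gf ((𝒳 ∩ 𝒵).filter fun S => 2 ≤ #S))
    - (gf (bySize (· = 2)) * gf univ.powerset) * (gf (𝒳.filter fun S => 2 ≤ #S) * gf (𝒵.filter fun S => 2 ≤ #S))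
    + (gf (bySize (· = 2)) * gf (bySize (· < 2))) * (gf univ.powerset * gf ((𝒳 ∩ 𝒵).filter fun S => 2 ≤ #S))
    - (gf (bySize (· = 2)) * gf (bySize (· < 2))) * (gf (𝒳.filter fun S => 2 ≤ #S) * gf (𝒵.filter fun S => 2 ≤ #S))
    - (gf (bySize (2 ≤ ·)) * gf univ.powerset) * (gf (bySize (· < 2)) * gf ((𝒳 ∩ 𝒵).filter fun S => #S = 2))
    - (gf (bySize (· = 2)) * gf (bySize (· < 2))) * (gf (𝒳.filter fun S => 2 ≤ #S) * gf (𝒵.filter fun S => #S < 2))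
    - (gf (bySize (· = 2)) * gf (bySize (· < 2))) * (gf (𝒳.filter fun S => #S < 2) * gf (𝒵.filter fun S => 2 ≤ #S))
    + (gf (bySize (· = 2)) * gf (bySize (2 ≤ ·))) * (gf (𝒳.filter fun S => #S < 2) * gf (𝒵.filter fun S => #S < 2)) :
      MvPolynomial α ℤ).coeff n := by
  refine coeff_Mtwo_nonneg_of_ladder h𝒳 h𝒵 (fun m => ?_) n
  have hcard : #({u, v} : Finset α) = 2 := card_pair huv
  have hW' : ((((𝒳.filter fun S => 2 ≤ #S) ∩ (𝒵.filter fun S => 2 ≤ #S))).filter fun S => #S = 2) = {{u, v}} := by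
    rw [← filter_two_le_inter, filter_two_le_filter_eq_two, hW]
  rw [show (PiP : MvPolynomial α ℤ) - Th1 = gf (bySize (2 ≤ ·) : Finset (Finset α)) from by rw [PiP_eq_Th1_add_gf_atLeastTwo]; ring]
  have h := coeff_ladder_two_singleEdge_nonneg (isUpperSet_filter_two_le h𝒳) (isUpperSet_filter_two_le h𝒵)
    (fun S hS => (mem_filter.1 hS).2) (fun S hS => (mem_filter.1 hS).2) huv
    (mem_filter.2 ⟨he𝒳, by rw [hcard]⟩) (mem_filter.2 ⟨he𝒵, by rw [hcard]⟩) hW' m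
  rw [show (PiP : MvPolynomial α ℤ) - Th1 = gf (bySize (2 ≤ ·) : Finset (Finset α)) from by rw [PiP_eq_Th1_add_gf_atLeastTwo]; ring] at h
  exact h

end Summit.CriticalPhenomena.PercolationContinuityZ3.Theorems.SahiCTCForms
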